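import Literature.AnabelianGeometry.AbsoluteAnabelian.AbsTopIII.LinearSystemsValuesProofs
import HarnessLib

/-!
# [AbsTopIII] Prop. 1.3 — proofs, part 2: a function with simple poles and the sum `λ + s`

Mochizuki, *Topics in Absolute Anabelian Geometry III*, §1, Proposition 1.3, manuscript pp. 30–31
(lit key `paper:url-5493eb38cbb7`).  PROOF-ONLY companion of `AbsTopIII/LinearSystems.lean`
(abc-iut-L4-t1), continuing `LinearSystemsValuesProofs`.  For ONE function field `K/k` of a proper
curve over an algebraically closed field `k` this file supplies an elementary replacement for the
linear systems of Prop. 1.2 used in the printed third step of the proof of Prop. 1.3 ("apply the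
characterizations of Proposition 1.2, (ii), (iii), to construct the additive structure of `k^×`"):

* `exists_fn_simple_poles`: a nonconstant function `s` with only SIMPLE poles exists, by Riemann's
  inequality applied to `g + 1` distinct points (tree: `degree_add_one_sub_genus_le_ell`,
  `infinite_placeOver'`, `ell_zero_eq_one`);
* `eq_const_add_of_witness` / `witness_const_add`: for such `s` and a constant `λ ≠ 0` the function
  `λ + s` is CHARACTERISED purely in terms of the data (a) `K^×`, (b) `ord_v`, (c) `U_v` of
  Prop. 1.3 — at poles of `s`, `h/s ∈ U_v`; at zeros of `s`, `h/λ ∈ U_v`; elsewhere `h` is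
  regular — because the difference of two such `h` would be a nonzero regular function with a
  zero;
* `exists_place_hasValue`: a nonconstant `s` takes every nonzero value `μ` at some point, so that
  reading off values characterises `λ + μ`;
* `eq_add_of_values`: `h = f + g` as soon as `h(x) = f(x) + g(x)` at every point where `f, g, h`
  are all invertible (printed last step: "the additive structure of `K_X^×` [i.e., by
  'evaluating' at various `v ∈ V_X`]"; tree: `infinite_placeOver'`, Stichtenoth Cor. 1.3.2/1.3.4).

No new definitions (proof-only companion).
-/

noncomputable section

open scoped Classical

namespace Literature.AnabelianGeometry.AbsoluteAnabelian.AbsTopIII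

open Literature.NumberTheory.DiophantineGeometry
open Literature.NumberTheory.DiophantineGeometry.AlgFunctionField

universe u v

variable {k : Type u} {K : Type v} [Field k] [Field K] [Algebra k K]

/-! ### A function with only simple poles (Riemann's inequality) -/

/-- There is a nonconstant function `s ∈ K` all of whose poles are simple: for `g + 1` distinct
points `P_0, …, P_g` (there are infinitely many, Stichtenoth Cor. 1.3.2) Riemann's inequality gives
`ℓ(P_0 + ⋯ + P_g) ≥ g + 2 − g = 2 > 1 = ℓ(0)`, so `L(P_0 + ⋯ + P_g) ⊋ L(0) = k`.  (This replaces
the linear systems of [AbsTopIII] Prop. 1.2 (i) in our discharge of Prop. 1.3.)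
[cite: MochizukiAbsTopIII2015, Prop 1.2 (i) p.29] -/
theorem exists_fn_simple_poles [IsAlgClosed k] [IsAlgFunctionField k K] :
    ∃ s : K, s ≠ 0 ∧ (∃ v : PlaceOver k K, v.ord s < 0) ∧
      ∀ v : PlaceOver k K, -1 ≤ v.ord s := by
  haveI := isIntegrallyClosedIn_of_isAlgClosed (k := k) (K := K)
  haveI : Infinite (PlaceOver k K) := infinite_placeOver'
  obtain ⟨S, hS⟩ := Infinite.exists_subset_card_eq (PlaceOver k K) (genus k K + 1)
  set D : Divisor k K := ∑ v ∈ S, Finsupp.single v 1 with hD_def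
  have hD_apply : ∀ w, D w = if w ∈ S then 1 else 0 := by
    intro w
    rw [hD_def, Finsupp.finsetSum_apply]
    simp only [Finsupp.single_apply]
    rw [Finset.sum_ite_eq' S w]
  have hD_le : ∀ w, D w ≤ 1 := fun w => by
    rw [hD_apply]; split_ifs <;> norm_num
  have hdeg : (genus k K : ℤ) + 1 ≤ D.degree := by
    rw [hD_def, map_sum]
    simp only [Divisor.degree_single, one_mul]
    have h1 : ∀ v ∈ S, (1 : ℤ) ≤ (v.degree : ℤ) := fun v _ => by
      exact_mod_cast PlaceOver.one_le_degree v
    have h2 := Finset.card_nsmul_le_sum S (fun v => (v.degree : ℤ)) 1 h1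
    rw [hS, nsmul_eq_mul, mul_one] at h2
    exact_mod_cast h2
  have hell : (2 : ℤ) ≤ ell D := by
    have := degree_add_one_sub_genus_le_ell (K := k) D
    linarith
  have hnot : ¬ (riemannRochSpace D ≤ riemannRochSpace (0 : Divisor k K)) := by
    intro hle
    haveI := finiteDimensional_riemannRochSpace_of_isAlgFunctionField (K := k) (F := K)
      (0 : Divisor k K)
    have h1 : ell D ≤ ell (0 : Divisor k K) := Submodule.finrank_mono hle
    rw [ell_zero_eq_one] at h1
    have : (ell D : ℤ) ≤ 1 := by exact_mod_cast h1
    linarith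
  obtain ⟨s, hsD, hs0⟩ := SetLike.not_le_iff_exists.1 hnot
  rw [mem_riemannRochSpace_zero_iff] at hs0
  push Not at hs0
  obtain ⟨v, hv⟩ := hs0
  have hs_ne : s ≠ 0 := by
    rintro rfl
    exact hv (zero_mem _)
  refine ⟨s, hs_ne, ⟨v, ?_⟩, fun w => ?_⟩
  · by_contra! hge
    exact hv ((v.mem_toValuationSubring_iff_ord_nonneg hs_ne).2 hge)
  · have := neg_apply_le_ord_of_mem_riemannRochSpace hsD hs_ne w
    have := hD_le w
    omega

/-! ### The characterisation of `λ + s` -/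

/-- SOUNDNESS of the multiplicative characterisation of `λ + s`.  Let `s` be nonconstant with only
simple poles, `λ ∈ k^×`, and let `h ∈ K^×` satisfy: at every pole `v` of `s`, `(h/s)(v) = 1`; at
every zero `v` of `s`, `h(v) = λ`; at every other place, `h` is regular.  Then `h = λ + s`.
Indeed `g := h − (λ + s)` is regular everywhere (at a simple pole `g = s · (h/s − 1) − λ` with
`h/s − 1 ∈ 𝔪_v` and `ord_v s = −1`) and vanishes at the zeros of `s`, so `g = 0` since a nonzero
regular function is a nonzero constant.  Only the data (a) `K^×`, (b) `ord_v`, (c) `U_v` of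
Prop. 1.3 (and the value `λ`) enter the hypotheses. [cite: MochizukiAbsTopIII2015, Prop 1.3 p.30] -/
theorem eq_const_add_of_witness [IsAlgClosed k] [IsAlgFunctionField k K] {s h : K} {a : k}
    (hs : s ≠ 0) (hh : h ≠ 0) (hpole : ∃ v : PlaceOver k K, v.ord s < 0)
    (hsimple : ∀ v : PlaceOver k K, -1 ≤ v.ord s)
    (h1 : ∀ v : PlaceOver k K, v.ord s < 0 → HasValue v (h / s) 1)
    (h2 : ∀ v : PlaceOver k K, 0 < v.ord s → HasValue v h a)
    (h3 : ∀ v : PlaceOver k K, v.ord s = 0 → 0 ≤ v.ord h) :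
    h = algebraMap k K a + s := by
  by_contra hne
  have hg : h - (algebraMap k K a + s) ≠ 0 := sub_ne_zero.2 hne
  -- (i) `g := h - (λ + s)` is regular everywhere
  have hint : ∀ v : PlaceOver k K, h - (algebraMap k K a + s) ∈ v.toValuationSubring := by
    intro v
    rcases lt_trichotomy (v.ord s) 0 with hlt | heq | hgt
    · -- a (simple) pole of `s`
      have hm1 : v.ord s = -1 := le_antisymm (by omega) (hsimple v)
      have hrw : h - (algebraMap k K a + s) = s * (h / s - 1) - algebraMap k K a := by
        rw [mul_sub, mul_div_cancel₀ _ hs]; ring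
      rw [hrw]
      refine sub_mem ?_ (v.algebraMap_mem a)
      rw [← v.toValuationSubring.valuation_le_one_iff, Valuation.map_mul]
      have hv1 : v.valuation (h / s - 1) ≤ v.valuation (v.uniformizer : K) := by
        have h1v : v.valuation (h / s - algebraMap k K 1) < 1 := h1 v hlt
        rw [map_one] at h1v
        exact v.valuation_le_valuation_uniformizer_of_lt_one h1v
      have hvs : v.valuation s = v.valuation (v.uniformizer : K) ^ (-1 : ℤ) := by
        rw [v.valuation_eq_zpow_ord hs, hm1]
      calc v.valuation s * v.valuation (h / s - 1)
          ≤ v.valuation (v.uniformizer : K) ^ (-1 : ℤ) * v.valuation (v.uniformizer : K) := by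
            rw [hvs]; exact mul_le_mul' le_rfl hv1
        _ = 1 := by
            rw [zpow_neg_one, inv_mul_cancel₀ (v.valuation_uniformizer_pos).ne']
    · -- `s` is a unit at `v`
      have hsO : s ∈ v.toValuationSubring := (v.mem_toValuationSubring_iff_ord_nonneg hs).2 heq.ge
      have hhO : h ∈ v.toValuationSubring :=
        (v.mem_toValuationSubring_iff_ord_nonneg hh).2 (h3 v heq)
      exact sub_mem hhO (add_mem (v.algebraMap_mem a) hsO)
    · -- a zero of `s`
      have hrw : h - (algebraMap k K a + s) = (h - algebraMap k K a) - s := by ring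
      rw [hrw]
      exact sub_mem (mem_toValuationSubring_of_valuation_lt_one v (h2 v hgt))
        ((v.mem_toValuationSubring_iff_ord_nonneg hs).2 hgt.le)
  -- hence `g` is a nonzero constant
  obtain ⟨c, hc0, hc⟩ := exists_algebraMap_eq_of_forall_ord_nonneg hg
    (fun v => PlaceOver.ord_nonneg_of_mem v (hint v))
  -- (ii) but `g` vanishes at a zero of `s`
  obtain ⟨w, hw⟩ := hpole
  obtain ⟨v, hv⟩ := exists_ord_pos hs hw.ne
  have hval : HasValue v (h - (algebraMap k K a + s)) 0 := by
    have hsv : HasValue v s 0 := (hasValue_zero_iff_ord_pos v hs).2 hv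
    have := (h2 v hv).sub ((hasValue_algebraMap v a).add hsv)
    simpa using this
  have hc' : HasValue v (h - (algebraMap k K a + s)) c := by
    rw [← hc]; exact hasValue_algebraMap v c
  exact hc0 (hc'.unique hval)

/-- COMPLETENESS of the characterisation: for `s` nonconstant with only simple poles and
`λ ∈ k^×`, the function `h := λ + s` is nonzero and satisfies the three clauses of
`eq_const_add_of_witness`. [cite: MochizukiAbsTopIII2015, Prop 1.3 p.30] -/
theorem witness_const_add [IsAlgFunctionField k K] {s : K} {a : k}
    (hs : s ≠ 0) (ha : a ≠ 0) (hpole : ∃ v : PlaceOver k K, v.ord s < 0) :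
    algebraMap k K a + s ≠ 0 ∧
    (∀ v : PlaceOver k K, v.ord s < 0 → HasValue v ((algebraMap k K a + s) / s) 1) ∧
    (∀ v : PlaceOver k K, 0 < v.ord s → HasValue v (algebraMap k K a + s) a) ∧
    (∀ v : PlaceOver k K, v.ord s = 0 → 0 ≤ v.ord (algebraMap k K a + s)) := by
  have ha' : algebraMap k K a ≠ 0 := (map_ne_zero _).2 ha
  have hne : algebraMap k K a + s ≠ 0 := by
    intro h0
    obtain ⟨w, hw⟩ := hpole
    have hs' : s = -algebraMap k K a := (neg_eq_of_add_eq_zero_right h0).symm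
    rw [hs', PlaceOver.ord_neg, PlaceOver.ord_algebraMap_holds w ha] at hw
    exact lt_irrefl _ hw
  refine ⟨hne, fun v hv => ?_, fun v hv => ?_, fun v hv => ?_⟩
  · -- at a pole: `(λ + s)/s - 1 = λ/s ∈ 𝔪_v`
    unfold HasValue
    have hrw : (algebraMap k K a + s) / s - algebraMap k K 1 = algebraMap k K a / s := by
      rw [map_one, add_div, div_self hs]; ring
    rw [hrw, Valuation.map_div, valuation_algebraMap_eq_one_of_ne_zero v ha, one_div]
    have h1 : 1 < v.valuation s := (v.one_lt_valuation_iff_ord_neg hs).2 hv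
    exact inv_lt_one_of_one_lt₀ h1
  · -- at a zero: `(λ + s) - λ = s ∈ 𝔪_v`
    unfold HasValue
    rw [add_sub_cancel_left]
    exact (v.valuation_lt_one_iff_ord_pos hs).2 hv
  · -- at a unit place of `s`
    exact PlaceOver.ord_nonneg_of_mem v (add_mem (v.algebraMap_mem a)
      ((v.mem_toValuationSubring_iff_ord_nonneg hs).2 hv.ge))

/-- A nonconstant `s` takes every nonzero value `μ`: there is a place `x` with `s(x) = μ` (a zero
of the nonconstant function `s − μ`, which has the same poles as `s`).
[cite: MochizukiAbsTopIII2015, Prop 1.3 p.30] -/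
theorem exists_place_hasValue [IsAlgClosed k] [IsAlgFunctionField k K] {s : K} {b : k}
    (hs : s ≠ 0) (hb : b ≠ 0) (hpole : ∃ v : PlaceOver k K, v.ord s < 0) :
    ∃ x : PlaceOver k K, HasValue x s b := by
  obtain ⟨w, hw⟩ := hpole
  have hb' : algebraMap k K b ≠ 0 := (map_ne_zero _).2 hb
  have hne : s - algebraMap k K b ≠ 0 := by
    intro h0
    rw [sub_eq_zero] at h0
    rw [h0, PlaceOver.ord_algebraMap_holds w hb] at hw
    exact lt_irrefl _ hw
  -- `s - μ` has a pole at `w` (same poles as `s`)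
  have hw' : w.ord (s - algebraMap k K b) < 0 := by
    have hlt : w.ord s < w.ord (-algebraMap k K b) := by
      rw [PlaceOver.ord_neg, PlaceOver.ord_algebraMap_holds w hb]; exact hw
    have := (w.ord_add_eq_left_of_lt hs (neg_ne_zero.2 hb') hlt).2
    rw [← sub_eq_add_neg] at this
    rw [this]; exact hw
  obtain ⟨x, hx⟩ := exists_ord_pos hne hw'.ne
  exact ⟨x, (x.valuation_lt_one_iff_ord_pos hne).2 hx⟩

/-! ### `h = f + g` from values at points -/

/-- "The additive structure of `K_X^×` [...] by evaluating at various `v ∈ V_X`" (p. 31): if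
`h(x) = f(x) + g(x)` at every point `x` at which `f, g, h` are all invertible, then `h = f + g`
(for nonzero `f, g, h`).  Indeed `h − (f + g)` vanishes at every such point outside its own
finite support, and all but finitely many of the infinitely many points qualify.
[cite: MochizukiAbsTopIII2015, Prop 1.3 p.31] -/
theorem eq_add_of_values [IsAlgClosed k] [IsAlgFunctionField k K] {F G H : K} (hF : F ≠ 0)
    (hG : G ≠ 0) (hH : H ≠ 0)
    (hQ : ∀ (v : PlaceOver k K) (a b c : k), a ≠ 0 → b ≠ 0 → c ≠ 0 →
      HasValue v F a → HasValue v G b → HasValue v H c → c = a + b) :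
    H = F + G := by
  by_contra hne
  have hu : H - (F + G) ≠ 0 := sub_ne_zero.2 hne
  haveI : Infinite (PlaceOver k K) := infinite_placeOver'
  have hfin : {v : PlaceOver k K | v.ord F ≠ 0 ∨ v.ord G ≠ 0 ∨ v.ord H ≠ 0 ∨
      v.ord (H - (F + G)) ≠ 0}.Finite := by
    refine ((((finite_setOf_ord_ne_zero_of_ne_zero (K := k) hF).union
      (finite_setOf_ord_ne_zero_of_ne_zero (K := k) hG)).union
      (finite_setOf_ord_ne_zero_of_ne_zero (K := k) hH)).union
      (finite_setOf_ord_ne_zero_of_ne_zero (K := k) hu)).subset ?_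
    intro v hv
    simp only [Set.mem_union, Set.mem_setOf_eq] at hv ⊢
    tauto
  obtain ⟨v, hv⟩ := hfin.infinite_compl.nonempty
  simp only [Set.mem_compl_iff, Set.mem_setOf_eq, not_or, not_not] at hv
  obtain ⟨hF0, hG0, hH0, hu0⟩ := hv
  obtain ⟨a, ha0, ha⟩ := exists_hasValue_ne_zero v hF hF0
  obtain ⟨b, hb0, hb⟩ := exists_hasValue_ne_zero v hG hG0
  obtain ⟨c, hc0, hc⟩ := exists_hasValue_ne_zero v hH hH0
  have hcab : c = a + b := hQ v a b c ha0 hb0 hc0 ha hb hc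
  have hval : HasValue v (H - (F + G)) 0 := by
    have h := hc.sub (ha.add hb)
    rwa [hcab, sub_self] at h
  have hpos := (hasValue_zero_iff_ord_pos v hu).1 hval
  omega

end Literature.AnabelianGeometry.AbsoluteAnabelian.AbsTopIII
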